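import Summits.ValiantsHypothesis.ValiantsHypothesis.Theorems.BarrierLeverChowBenchmarkPairsBlockPeelCert724
import Summits.ValiantsHypothesis.ValiantsHypothesis.Theorems.BarrierLeverChowBenchmarkPairsBlockPeelCertR724x2
import Summits.ValiantsHypothesis.ValiantsHypothesis.Theorems.BarrierLeverChowBenchmarkPairsBlockPeelCertR724x3
import Summits.ValiantsHypothesis.ValiantsHypothesis.Theorems.BarrierLeverChowBenchmarkPairsBlockPeelCertB892
import Summits.ValiantsHypothesis.ValiantsHypothesis.Theorems.BarrierLeverChowBenchmarkPairsBlockPeelCertB959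
import Summits.ValiantsHypothesis.ValiantsHypothesis.Theorems.BarrierLeverChowBenchmarkPairsBlockPeelCertB1149

/-!
# Route BarrierLever — item 22038 `ChowBenchmarkPairs`, line `moore-peel`: RUNG 1459 OF THE COMPUTATIONAL LANE — node #1
# `SegmentMeanValueAt h` and the item's own body for EVERY `h ≤ 1459` (`Lean.ofReduceBool`)

Helper file, **computational (`Lean.ofReduceBool`, inherited from the ten block certificates)** (`--computational --supports
stmt-ValiantsHypothesis-22038`; cell valiant-natproofs, rung V4, 𝒟-side benchmark of record, line `moore_peel`; seat val-np-p4 gen 30).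
Closes NO item; definition-free.

ASSEMBLY.  THEOREM W's bad stages below `1460` are `183, 364, 444, 573, 628, 725, 726, 892, 959, 1149` (`bad_le_1459`, kernel table):
eight isolated ones and the 2-run `725–726`; the next bad stages `1460, 1461` form a 2-run whose prefix block `{1459, 1460, 1461}` (`4 380²`)
is beyond the present certificate cost.  CONJECTURE P′ up to `1459` (`Stmt.conjPrefixUpTo 1459`, `…BlockPeelLadder`) therefore asks for
exactly TEN symbolic block determinants — the 2-blocks `{b-1, b}` over the isolated bad stages and the prefix blocks `{724,725}`,
`{724,725,726}` of the run — all certified in the computational lane with ZERO data: `{182,183}` (p712340), `{363,364}` / `{443,444}` /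
`{572,573}` / `{627,628}` (kits `…CertLU`/`…CertLUP`/`…CertPack`), `{724,725}`, `{724,725,726}`, `{891,892}`, `{958,959}`, `{1148,1149}`
(kit `…CertPackFast` + packed LU).  Hence `conjPrefixUpTo_1459_cert` and

* **`kernelPoisedAt_factorial_of_le_1459_cert`**, **`segmentMeanValueAt_of_le_1459_cert`** — node #1's statement VERBATIM ∀ `h ≤ 1459`;
* **`chowBenchmarkPairs_body_of_le_1459_cert`** — the ROUTE DECL's body for every `h ≤ 1459` (zeon dualisation `stub_dualisation`).

RANGES OF NODE #1 (RULING R43 (b), never merged): KERNEL `h ≤ 182` · COMPUTATIONAL `h ≤ 1459` (this file; `724` by `…Cert724`, `363` by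
p712340/p713529) · NUMERICAL `h ≤ 20 069` · CONJECTURAL ∀ h (`Stmt.conjB3` / `Stmt.conjPrefix`).

WHAT THIS IS NOT: node #1 (∀ h) and the item are NOT closed; nothing on crux stmt-ValiantsHypothesis-14610 or on `VP` versus `VNP`.
-/

set_option linter.dupNamespace false

namespace Summit.ValiantsHypothesis.ValiantsHypothesis.Theorems.BarrierLever.MoorePeel

/-- THEOREM W's table: the bad stages `≤ 1459`. -/
theorem bad_le_1459 : ∀ b ∈ List.range 1460, b ∈ badStagesLe5000 →
    b = 183 ∨ b = 364 ∨ b = 444 ∨ b = 573 ∨ b = 628 ∨ b = 725 ∨ b = 726 ∨ b = 892 ∨ b = 959 ∨ b = 1149 := by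
  decide +kernel

/-- **CONJECTURE P′ up to `1459` from ten symbolic block determinants.** -/
theorem conjPrefixUpTo_1459
    (h183 : (blockMatrix Nat.factorial 182 2 (fun s : Fin 2 => (MvPolynomial.X s : MvPolynomial (Fin 2) ℤ))).det ≠ 0)
    (h364 : (blockMatrix Nat.factorial 363 2 (fun s : Fin 2 => (MvPolynomial.X s : MvPolynomial (Fin 2) ℤ))).det ≠ 0)
    (h444 : (blockMatrix Nat.factorial 443 2 (fun s : Fin 2 => (MvPolynomial.X s : MvPolynomial (Fin 2) ℤ))).det ≠ 0)
    (h573 : (blockMatrix Nat.factorial 572 2 (fun s : Fin 2 => (MvPolynomial.X s : MvPolynomial (Fin 2) ℤ))).det ≠ 0)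
    (h628 : (blockMatrix Nat.factorial 627 2 (fun s : Fin 2 => (MvPolynomial.X s : MvPolynomial (Fin 2) ℤ))).det ≠ 0)
    (h725 : (blockMatrix Nat.factorial 724 2 (fun s : Fin 2 => (MvPolynomial.X s : MvPolynomial (Fin 2) ℤ))).det ≠ 0)
    (h726 : (blockMatrix Nat.factorial 724 3 (fun s : Fin 3 => (MvPolynomial.X s : MvPolynomial (Fin 3) ℤ))).det ≠ 0)
    (h892 : (blockMatrix Nat.factorial 891 2 (fun s : Fin 2 => (MvPolynomial.X s : MvPolynomial (Fin 2) ℤ))).det ≠ 0)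
    (h959 : (blockMatrix Nat.factorial 958 2 (fun s : Fin 2 => (MvPolynomial.X s : MvPolynomial (Fin 2) ℤ))).det ≠ 0)
    (h1149 : (blockMatrix Nat.factorial 1148 2 (fun s : Fin 2 => (MvPolynomial.X s : MvPolynomial (Fin 2) ℤ))).det ≠ 0) :
    Stmt.conjPrefixUpTo 1459 := by
  intro g b h1 hgb hbH hg hbad
  -- `g + 1` and `b` are bad stages of the table
  have hg1 : g + 1 ∈ badStagesLe5000 :=
    (det_peelMatrix_eq_zero_iff_mem_of_le_5000 (g + 1) (by omega) (by omega)).mp (hbad (g + 1) (by omega) (by omega))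
  have hgood : ∀ j, g < j → j ≤ b → j ∈ badStagesLe5000 := fun j hj1 hj2 =>
    (det_peelMatrix_eq_zero_iff_mem_of_le_5000 j (by omega) (by omega)).mp (hbad j hj1 hj2)
  -- so `g + 1` is one of the ten; `g` itself is good, and `b` cannot pass the next good stage
  rcases bad_le_1459 (g + 1) (List.mem_range.mpr (by omega)) hg1 with e | e | e | e | e | e | e | e | e | e
  · -- g = 182, b = 183
    have hb : b = 183 := by
      by_contra hne
      exact absurd (hgood 184 (by omega) (by omega)) (by decide)
    subst hb; obtain rfl : g = 182 := by omega
    exact h183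
  · have hb : b = 364 := by
      by_contra hne
      exact absurd (hgood 365 (by omega) (by omega)) (by decide)
    subst hb; obtain rfl : g = 363 := by omega
    exact h364
  · have hb : b = 444 := by
      by_contra hne
      exact absurd (hgood 445 (by omega) (by omega)) (by decide)
    subst hb; obtain rfl : g = 443 := by omega
    exact h444
  · have hb : b = 573 := by
      by_contra hne
      exact absurd (hgood 574 (by omega) (by omega)) (by decide)
    subst hb; obtain rfl : g = 572 := by omega
    exact h573
  · have hb : b = 628 := by
      by_contra hne
      exact absurd (hgood 629 (by omega) (by omega)) (by decide)
    subst hb; obtain rfl : g = 627 := by omega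
    exact h628
  · -- g = 724, b ∈ {725, 726}
    obtain rfl : g = 724 := by omega
    have hb : b = 725 ∨ b = 726 := by
      by_contra hne
      push Not at hne
      exact absurd (hgood 727 (by omega) (by omega)) (by decide)
    rcases hb with rfl | rfl
    · exact h725
    · exact h726
  · -- g + 1 = 726: then g = 725 would be good — it is not
    exfalso
    have : (725 : ℕ) ∉ badStagesLe5000 := fun hmem => by
      have hg' := hg
      rw [show g = 725 by omega] at hg'
      exact hg' ((det_peelMatrix_eq_zero_iff_mem_of_le_5000 725 (by norm_num) (by norm_num)).mpr hmem)
    exact this (by decide)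
  · have hb : b = 892 := by
      by_contra hne
      exact absurd (hgood 893 (by omega) (by omega)) (by decide)
    subst hb; obtain rfl : g = 891 := by omega
    exact h892
  · have hb : b = 959 := by
      by_contra hne
      exact absurd (hgood 960 (by omega) (by omega)) (by decide)
    subst hb; obtain rfl : g = 958 := by omega
    exact h959
  · have hb : b = 1149 := by
      by_contra hne
      exact absurd (hgood 1150 (by omega) (by omega)) (by decide)
    subst hb; obtain rfl : g = 1148 := by omega
    exact h1149

/-- **CONJECTURE P′ up to `1459`, certified** (computational lane). -/
theorem conjPrefixUpTo_1459_cert : Stmt.conjPrefixUpTo 1459 :=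
  conjPrefixUpTo_1459 det_blockMatrix_182_2_ne_zero det_blockMatrix_363_2_ne_zero det_blockMatrix_443_2_ne_zero
    det_blockMatrix_572_2_ne_zero det_blockMatrix_627_2_ne_zero det_blockMatrix_724_2_ne_zero det_blockMatrix_724_3_ne_zero
    det_blockMatrix_891_2_ne_zero det_blockMatrix_958_2_ne_zero det_blockMatrix_1148_2_ne_zero

/-- **`KernelPoisedAt k! h` for every `h ≤ 1459`** (computational lane). -/
theorem kernelPoisedAt_factorial_of_le_1459_cert (h : ℕ) (hh : h ≤ 1459) : KernelPoisedAt Nat.factorial h :=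
  kernelPoisedAt_factorial_of_conjPrefixUpTo 1459 conjPrefixUpTo_1459_cert h hh

/-- **`SegmentMeanValueAt h` for EVERY `h ≤ 1459`, VERBATIM (computational lane, `Lean.ofReduceBool`)** — node #1's statement on
`[0, 1459]`: THEOREM W + the block peel theorem + ten certified tied blocks. -/
theorem segmentMeanValueAt_of_le_1459_cert (h : ℕ) (hh : h ≤ 1459) :
    ∀ (r : ℕ) (u : Fin r → Finset (Fin h)), Function.Injective u → (∀ i, (u i).card ≤ 2) →
      (∀ S : Finset (Fin h), S.card ≤ 2 → ∃ i, u i = S) →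
      ∃ P : Fin h → Fin h → ℂ,
        (Matrix.of fun i j : Fin r =>
          ∑ g : (↥(benchCols h r j) → ↥(u i)), (∏ c : ↥(benchCols h r j), P (g c) c) *
            ∏ a : ↥(u i),
              ((Finset.univ.filter fun c : ↥(benchCols h r j) => g c = a).card.factorial : ℂ)).det ≠ 0 :=
  kernelPoisedAt_factorial_of_le_1459_cert h hh

/-- **The body of item 22038 `ChowBenchmarkPairs` for every `h ≤ 1459`** (computational lane), by the zeon dualisation. -/
theorem chowBenchmarkPairs_body_of_le_1459_cert (h : ℕ) (hh : h ≤ 1459) :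
    ∀ (r : ℕ) (u : Fin r → Finset (Fin h)), Function.Injective u → (∀ i, (u i).card ≤ 2) →
      (∀ S : Finset (Fin h), S.card ≤ 2 → ∃ i, u i = S) →
      ∃ B : Fin h → Fin h → ℂ,
        (Matrix.of fun i j : Fin r => MvPolynomial.coeff
          (∑ a ∈ u i, Finsupp.single (Fin.castAdd h a) 1 +
            ∑ c ∈ Finset.univ.filter (fun c : Fin h => Nat.testBit (j : ℕ) (c : ℕ)), Finsupp.single (Fin.natAdd h c) 1)
          (∏ a : Fin h, (MvPolynomial.X (Fin.castAdd h a) + 1 +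
            ∑ c : Fin h, MvPolynomial.C (B a c) * MvPolynomial.X (Fin.natAdd h c)))).det ≠ 0 :=
  ChowBenchmarkDual.stub_dualisation h (segmentMeanValueAt_of_le_1459_cert h hh)

end Summit.ValiantsHypothesis.ValiantsHypothesis.Theorems.BarrierLever.MoorePeel
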